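import Summits.QuantumFields.YangMills.Theorems.UnitScaleTiltHalvingP1FlatCoreTopTargetRep
import Summits.QuantumFields.YangMills.Theorems.UnitScaleTiltProp8ChartDoubleBarSU2
import Literature.MathematicalPhysics.QuantumFieldTheory.Balaban1983to89.B8SpecialUnitaryTrace
import HarnessLib

/-!
# Line H (`BirthV10.stub_halvingStep`, stmt-QuantumFields-19200), J4c (T4b)∕τ-thread: **THE TARGET OF THE TOP STEP IS TRACE-FREE** — the `hthτ` binder of the
# τ-twin `P1FlatCoreTopStepTorus.hFP_kLevel_top_RD_traceFree` ((τ-3), ★w8-19936 g3) for the SAME target `th` as ✓`P1FlatCoreTopTargetRep.exists_topTarget_of_axialT`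
# ((T4b) FILE 4, ★w8-19936 g2), from `det = 1` fine data

Cell `ym3-torus` (HUMAN RULING D-0037: YM₃ on T³ is ladder rung R3, NOT the Clay problem), width seat `ym-ust-19936-w3` (gen 7; τ-thread row (τ-1) and its feeds, LEAD-H L-10).
`--supports stmt-QuantumFields-19200 --as helper`; THEOREMS ONLY (0 `def`, 0 `sorry`); count-neutral; nothing here claims `core′`, `hSupU`, the stub, the crux or the gap.

WHY.  The τ-twin of the top socket carries, besides the four dictionary clauses of the target `th` (skew, `th (k, yc) = log v₀(W̿₁^{(k)}; y₀, π_k yc)` on `Λ`, zero below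
the top, `‖th‖ ≤ τ`), the clause `hthτ : ∀ p, τ (th p) = 0`.  At the door's `M₂(ℂ)` with `τ := tr` this is `det v₀(W̿₁^{(k)}; y₀, π_k yc) = 1` read through the series
logarithm: the axial transporter `v₀ = W̿₁^{(k)}(Γ_{y₀,x})` (`axialT = holT ∘ treeWord`) is a product of level-`k` double-bar bond variables and their inverses, each of
determinant one for a `det = 1` fine field under the budget (✓`Prop8ChartDoubleBar.det_dbarIterU_eq_one_of_reads`, ✓`holT_pred_of_walk`), and `‖v₀ − 1‖ ≤ τ∕2 ≤ 1∕3`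
is already among the binders, so lit ✓`BlockAveragingExpMeanLog.trace_mlog_eq_zero_of_det_eq_one` applies (winding guard automatic for `2 × 2`).  The fifth clause then
follows from ✓`P1FlatCoreTopDictionary.exists_topTarget`'s SUPPORT clause (`th (k, y) = 0` off `Λ`), which ✓`exists_topTarget_of_axialT` does not export — hence a
twin theorem rather than a corollary; its first four clauses and its proof lines are ✓p642293's verbatim.

WHAT IS PROVED (ns `…P1FlatCoreTopTargetRep`, next to the original):
* §1 `det_holT_dbarIterU_eq_one` — every transporter of the double-bar tower of a `det = 1` field (within `s₀` of `1`, budget at its level) has `det = 1`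
  (det-twin of ✓`P1FlatCoreFrameLinStar.holT_dbarIterU_mem_unitaryGroup`); `det_axialT_dbarIterU_eq_one`; `trCLM_mlog_axialT_eq_zero` (guard `‖v₀ − 1‖ ≤ 1∕3`).
* §2 ★★ `exists_topTarget_of_axialT_traceFree` — ✓`exists_topTarget_of_axialT`'s binders + `hdet : ∀ b, det W₁(b) = 1` ⟹ its four clauses ∧ `∀ p, trCLM (Fin 2) (th p) = 0`.
HONEST SCOPE.  Bookkeeping; no estimate.  The `_of_reads` locality of `hW₁` (★w3-20520 g6's (D) ask) is NOT addressed here — binders as in ✓p642293.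

References: T. Bałaban, CMP **99** (1985) 75–102 [Balaban1985RegularSpaces] (p.76 «𝔤 = su(N)», (1.17) p.78, Sect. E (1.91)–(1.92) p.98); CMP **98** (1985) 17–51
[Balaban1985Averaging] ((8)–(9) pp.18–19, (20)–(23) p.21, p.24, Prop. 4 (134)–(135) p.38); CMP **109** (1987) 249–301 [Balaban1987RG1] (before (0.5) p.253).
-/

set_option autoImplicit false

noncomputable section

open scoped BigOperators Matrix.Norms.L2Operator

namespace Summit.QuantumFields.YangMills.Theorems.P1FlatCoreTopTargetRep

open Literature.MathematicalPhysics.QuantumFieldTheory.Balaban1983to89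
open T4Continuum MatrixLog
open B14DomainGeom (Pt)
open Node00 (coverAt)
open B10Eq27TorusAxialLog (rel axialT holT)
open B7Prop1Explicit (treeWord)
open ExpMeanLog (star_mlog_eq_neg trace_mlog_eq_zero_of_det_eq_one)
open B8Eq1117Concrete (XSpace)
open B8SpecialUnitaryTrace (trCLM trCLM_apply)
open Summit.QuantumFields.YangMills.Theorems.Prop8ChartDoubleBar (dbarIterU holT_pred_of_walk det_dbarIterU_eq_one_of_reads det_coe_units_inv_eq_one
  two_mul_lt_pi_of_le_third)
open Summit.QuantumFields.YangMills.Theorems.P1FlatCoreFrameLinStar (holT_dbarIterU_mem_unitaryGroup)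
open Summit.QuantumFields.YangMills.Theorems.P1FlatCoreTopDictionary (exists_topTarget)

variable {P : Params}

/-! ## §1 `det = 1` along the transporters of the double-bar tower; the axial transporter is trace-free in the logarithm -/

section Det

/-- **EVERY TRANSPORTER OF THE DOUBLE-BAR TOWER OF A `det = 1` FIELD HAS `det = 1`**: if every bond variable of `U` has `det = 1` and is within `s₀` of `1`,
`8·3800·((d+2)L)²·Lⁱ·s₀ ≤ 1`, then `det U̿^{(i)}(Γ_{x,w}) = 1` for every level-`i` walk (the multiplicative predicate `det = 1` along the walk, ✓`holT_pred_of_walk`; on the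
level-`i` bonds by ✓`det_dbarIterU_eq_one_of_reads` on the whole torus) — det-twin of ✓`P1FlatCoreFrameLinStar.holT_dbarIterU_mem_unitaryGroup`.
[cite: Balaban1985Averaging, (8)-(9) pp.18-19, Prop. 4 (134)-(135) p.38; Balaban1987RG1, before (0.5) p.253] -/
theorem det_holT_dbarIterU_eq_one {i : ℕ} (hi : i ≤ P.m + P.K) (U : GaugeField P 0 (Matrix (Fin 2) (Fin 2) ℂ)ˣ) {s₀ : ℝ} (hs₀ : 0 ≤ s₀)
    (hbudget : 8 * 3800 * (((P.d + 2) * P.L : ℕ) : ℝ) ^ 2 * (P.L : ℝ) ^ i * s₀ ≤ 1)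
    (hU : ∀ b : PBond P 0, ‖((U b : (Matrix (Fin 2) (Fin 2) ℂ)ˣ) : Matrix (Fin 2) (Fin 2) ℂ) - 1‖ ≤ s₀)
    (hdet : ∀ b : PBond P 0, ((U b : (Matrix (Fin 2) (Fin 2) ℂ)ˣ) : Matrix (Fin 2) (Fin 2) ℂ).det = 1)
    (x : Site P i) (w : List (Letter P.d)) :
    ((holT (dbarIterU i U) x w : (Matrix (Fin 2) (Fin 2) ℂ)ˣ) : Matrix (Fin 2) (Fin 2) ℂ).det = 1 :=
  holT_pred_of_walk (fun a : (Matrix (Fin 2) (Fin 2) ℂ)ˣ => (a : Matrix (Fin 2) (Fin 2) ℂ).det = 1)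
    (by rw [Units.val_one, Matrix.det_one]) (fun a b ha hb => by rw [Units.val_mul, Matrix.det_mul, ha, hb, one_mul])
    (fun a ha => det_coe_units_inv_eq_one ha) (dbarIterU i U) x w fun st _ =>
      det_dbarIterU_eq_one_of_reads hi Set.univ U hs₀ hbudget (fun b _ _ => hU b) (fun b _ _ => hdet b) st.bond (Set.mem_univ _) (Set.mem_univ _)

/-- **THE AXIAL TRANSPORTER OF A `det = 1` FIELD HAS `det = 1`** (`axialT V y x = V(Γ_{y, treeWord (rel y x)})`). [cite: Balaban1985Averaging, (8)-(9) pp.18-19, p.24] -/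
theorem det_axialT_dbarIterU_eq_one {i : ℕ} (hi : i ≤ P.m + P.K) (U : GaugeField P 0 (Matrix (Fin 2) (Fin 2) ℂ)ˣ) {s₀ : ℝ} (hs₀ : 0 ≤ s₀)
    (hbudget : 8 * 3800 * (((P.d + 2) * P.L : ℕ) : ℝ) ^ 2 * (P.L : ℝ) ^ i * s₀ ≤ 1)
    (hU : ∀ b : PBond P 0, ‖((U b : (Matrix (Fin 2) (Fin 2) ℂ)ˣ) : Matrix (Fin 2) (Fin 2) ℂ) - 1‖ ≤ s₀)
    (hdet : ∀ b : PBond P 0, ((U b : (Matrix (Fin 2) (Fin 2) ℂ)ˣ) : Matrix (Fin 2) (Fin 2) ℂ).det = 1)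
    (y x : Site P i) :
    ((axialT (dbarIterU i U) y x : (Matrix (Fin 2) (Fin 2) ℂ)ˣ) : Matrix (Fin 2) (Fin 2) ℂ).det = 1 := by
  unfold axialT
  exact det_holT_dbarIterU_eq_one hi U hs₀ hbudget hU hdet y _

/-- **`tr log v₀ = 0` FOR THE AXIAL TRANSPORTER OF A `det = 1` FIELD WITHIN `1∕3` OF `1`** (lit ✓`trace_mlog_eq_zero_of_det_eq_one`; the winding guard `2·‖v₀ − 1‖ < π`
is automatic below `1∕3`, ✓`two_mul_lt_pi_of_le_third`). [cite: Balaban1985RegularSpaces, p.76, (1.17) p.78; Balaban1985Averaging, (20)-(23) p.21, p.24] -/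
theorem trCLM_mlog_axialT_eq_zero {i : ℕ} (hi : i ≤ P.m + P.K) (U : GaugeField P 0 (Matrix (Fin 2) (Fin 2) ℂ)ˣ) {s₀ : ℝ} (hs₀ : 0 ≤ s₀)
    (hbudget : 8 * 3800 * (((P.d + 2) * P.L : ℕ) : ℝ) ^ 2 * (P.L : ℝ) ^ i * s₀ ≤ 1)
    (hU : ∀ b : PBond P 0, ‖((U b : (Matrix (Fin 2) (Fin 2) ℂ)ˣ) : Matrix (Fin 2) (Fin 2) ℂ) - 1‖ ≤ s₀)
    (hdet : ∀ b : PBond P 0, ((U b : (Matrix (Fin 2) (Fin 2) ℂ)ˣ) : Matrix (Fin 2) (Fin 2) ℂ).det = 1)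
    (y x : Site P i) (hsm : ‖((axialT (dbarIterU i U) y x : (Matrix (Fin 2) (Fin 2) ℂ)ˣ) : Matrix (Fin 2) (Fin 2) ℂ) - 1‖ ≤ 1 / 3) :
    trCLM (Fin 2) (mlog ((axialT (dbarIterU i U) y x : (Matrix (Fin 2) (Fin 2) ℂ)ˣ) : Matrix (Fin 2) (Fin 2) ℂ)) = 0 := by
  rw [trCLM_apply]
  exact trace_mlog_eq_zero_of_det_eq_one (det_axialT_dbarIterU_eq_one hi U hs₀ hbudget hU hdet y x) hsm (two_mul_lt_pi_of_le_third hsm)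

end Det

/-! ## §2 The trace-free target -/

section Target

/-- ★★ **THE TARGET OF THE TOP STEP IS TRACE-FREE** — ✓`exists_topTarget_of_axialT` with the extra datum `det W₁(b) = 1` and the extra clause
`∀ p, tr (th p) = 0` (the `hthτ` binder of the τ-twin socket `hFP_kLevel_top_RD_traceFree` at `τ := trCLM (Fin 2)`, for the same `th`): fine torus `P`, top level
`k ≤ m + K`, a unitary-valued `det = 1` field `W₁` within `s₀` of `1`, budget `8·3800·((d+2)L)²·Lᵏ·s₀ ≤ 1`, base point `y₀`, top labels `Λ`, `0 ≤ τ ≤ 2∕3` with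
`‖v₀(W̿₁^{(k)}; y₀, π_k yc) − 1‖ ≤ τ∕2` on `Λ`.  Then there is `th : XSpace d k M₂(ℂ)`, skew, `= log v₀(W̿₁^{(k)}; y₀, π_k yc)` on the top labels of `Λ`, zero below the top,
`‖th‖ ≤ τ`, and TRACE-FREE everywhere (`tr log v₀ = 0` by §1 on `Λ`; zero below the top and off `Λ` by ✓`exists_topTarget`'s support clause).
[cite: Balaban1985RegularSpaces, p.76, (1.17) p.78, Sect. E (1.91)-(1.92) p.98; Balaban1985Averaging, (23) p.21, p.24] -/
theorem exists_topTarget_of_axialT_traceFree {k : ℕ} (hk : k ≤ P.m + P.K) (W₁ : GaugeField P 0 (Matrix (Fin 2) (Fin 2) ℂ)ˣ)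
    {s₀ : ℝ} (hs₀ : 0 ≤ s₀) (hbudget : 8 * 3800 * (((P.d + 2) * P.L : ℕ) : ℝ) ^ 2 * (P.L : ℝ) ^ k * s₀ ≤ 1)
    (hW₁ : ∀ b : PBond P 0, ‖((W₁ b : (Matrix (Fin 2) (Fin 2) ℂ)ˣ) : Matrix (Fin 2) (Fin 2) ℂ) - 1‖ ≤ s₀)
    (hWu : ∀ b : PBond P 0, ((W₁ b : (Matrix (Fin 2) (Fin 2) ℂ)ˣ) : Matrix (Fin 2) (Fin 2) ℂ) ∈ Matrix.unitaryGroup (Fin 2) ℂ)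
    (hdet : ∀ b : PBond P 0, ((W₁ b : (Matrix (Fin 2) (Fin 2) ℂ)ˣ) : Matrix (Fin 2) (Fin 2) ℂ).det = 1)
    (y₀ : Site P k) (Λ : Set (Pt P.d)) {τ : ℝ} (hτ : 0 ≤ τ) (hτ3 : τ ≤ 2 / 3)
    (hsmall : ∀ yc ∈ Λ, ‖((axialT (dbarIterU k W₁) y₀ (coverAt P k yc) : (Matrix (Fin 2) (Fin 2) ℂ)ˣ) : Matrix (Fin 2) (Fin 2) ℂ) - 1‖ ≤ τ / 2) :
    ∃ th : XSpace P.d k (Matrix (Fin 2) (Fin 2) ℂ),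
      (∀ p, star (th p) = -th p) ∧
      (∀ yc ∈ Λ, th (⟨k, Nat.lt_succ_self k⟩, yc) =
        mlog ((axialT (dbarIterU k W₁) y₀ (coverAt P k yc) : (Matrix (Fin 2) (Fin 2) ℂ)ˣ) : Matrix (Fin 2) (Fin 2) ℂ)) ∧
      (∀ (j : ℕ) (hj : j < k) (y : Pt P.d), th (⟨j, Nat.lt_succ_of_lt hj⟩, y) = 0) ∧
      ‖th‖ ≤ τ ∧
      (∀ p, trCLM (Fin 2) (th p) = 0) := by
  have ht : ∀ yc ∈ Λ, ‖mlog ((axialT (dbarIterU k W₁) y₀ (coverAt P k yc) : (Matrix (Fin 2) (Fin 2) ℂ)ˣ) : Matrix (Fin 2) (Fin 2) ℂ)‖ ≤ τ :=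
    fun yc hyc => (norm_mlog_le_two_mul ((hsmall yc hyc).trans (by linarith))).trans (by linarith [hsmall yc hyc])
  have hskew : ∀ yc ∈ Λ, star (mlog ((axialT (dbarIterU k W₁) y₀ (coverAt P k yc) : (Matrix (Fin 2) (Fin 2) ℂ)ˣ) : Matrix (Fin 2) (Fin 2) ℂ)) =
      -mlog ((axialT (dbarIterU k W₁) y₀ (coverAt P k yc) : (Matrix (Fin 2) (Fin 2) ℂ)ˣ) : Matrix (Fin 2) (Fin 2) ℂ) := fun yc hyc =>
    star_mlog_eq_neg (holT_dbarIterU_mem_unitaryGroup hk W₁ hs₀ hbudget hW₁ hWu y₀ _) ((hsmall yc hyc).trans (by linarith))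
  have htr : ∀ yc ∈ Λ, trCLM (Fin 2) (mlog ((axialT (dbarIterU k W₁) y₀ (coverAt P k yc) : (Matrix (Fin 2) (Fin 2) ℂ)ˣ) : Matrix (Fin 2) (Fin 2) ℂ)) = 0 :=
    fun yc hyc => trCLM_mlog_axialT_eq_zero hk W₁ hs₀ hbudget hW₁ hdet y₀ _ ((hsmall yc hyc).trans (by linarith))
  obtain ⟨th, h1, h2, h3, h4, h5⟩ := exists_topTarget k Λ
    (fun yc => mlog ((axialT (dbarIterU k W₁) y₀ (coverAt P k yc) : (Matrix (Fin 2) (Fin 2) ℂ)ˣ) : Matrix (Fin 2) (Fin 2) ℂ)) hτ ht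
  refine ⟨th, h5 hskew, h1, h2, h4, fun p => ?_⟩
  obtain ⟨q, y⟩ := p
  by_cases hqk : (q : ℕ) = k
  · have hq : q = ⟨k, Nat.lt_succ_self k⟩ := Fin.ext hqk
    rw [hq]
    by_cases hy : y ∈ Λ
    · rw [h1 y hy]; exact htr y hy
    · rw [h3 y hy, map_zero]
  · have hlt : (q : ℕ) < k := lt_of_le_of_ne (Nat.lt_succ_iff.mp q.isLt) hqk
    have hq : q = ⟨(q : ℕ), Nat.lt_succ_of_lt hlt⟩ := Fin.ext rfl
    rw [hq, h2 (q : ℕ) hlt y, map_zero]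

end Target

end Summit.QuantumFields.YangMills.Theorems.P1FlatCoreTopTargetRep

end
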